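import Mathlib.MeasureTheory.Integral.IntervalIntegral.Basic
import Mathlib.Analysis.SpecialFunctions.Integrals.Basic
import Mathlib.NumberTheory.Harmonic.EulerMascheroni
import Mathlib.Analysis.Asymptotics.AsymptoticEquivalent
import HarnessLib

-- provenance: harness21/H21/H21/Prelude/AntSieve/LogIntegral.lean @ 12e2ffd (interim HEAD d8f2665); M5 mechanical rewrite
/-!
# The logarithmic integral `li` and the offset logarithmic integral `Li`

Trunk T-ANT / T-SIEVE (outline `AntSieve.md`, §C1, design decision D-ANT-7), notion
`log_integral_li`.

We define

* `Literature.logIntegral x` — the logarithmic integral `li x = p.v. ∫₀ˣ dt / log t`, given for `x > 1`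
  by the absolutely convergent series
  `li x = γ + log (log x) + ∑_{n ≥ 1} (log x)^n / (n · n!)`
  (Nielsen 1906; Berndt, *Ramanujan's Notebooks* IV, ch. 24; Abramowitz–Stegun 5.1.10 with
  `li x = Ei (log x)`);
* `Literature.offsetLogIntegral x` — the offset (Eulerian) logarithmic integral `Li x = ∫₂ˣ dt / log t`;
* `Literature.offsetLogIntegralPow k x` — `∫₂ˣ dt / (log t)^k`, the main term of the Hardy–Littlewood
  `k`-tuple conjecture.

Mathlib (at the pinned commit) has no logarithmic integral (searched `logIntegral`,
`LogIntegral`, `log_integral`); it provides the anchors `intervalIntegral`,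
`Real.eulerMascheroniConstant`, `Real.log` and `Asymptotics.IsEquivalent` used here.

## Design choices

* The series form avoids principal-value integrals entirely; for `x ≤ 1` the value of
  `logIntegral x` is junk (`Real.log` of a nonpositive number is defined via `|·|`, `log 0 = 0`,
  and `tsum` of a non-summable family is `0`). All API lemmas carry the hypothesis `1 < x`.
* `offsetLogIntegral` and `offsetLogIntegralPow` are honest interval integrals; the integrands
  are continuous on `(1, ∞)`, so for `x ≥ 2` (indeed `x > 1`) no junk arises. For `x < 2` the
  interval-integral sign convention applies.
* Asymptotics are phrased with `Asymptotics.IsEquivalent atTop` (D-SIEVE-3).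

## References

* L. Schoenfeld, *Sharper bounds for the Chebyshev functions θ(x) and ψ(x). II*,
  Math. Comp. 30 (1976), 337–360.
* B. C. Berndt, *Ramanujan's Notebooks, Part IV*, Springer 1994, ch. 24 (series for `li`).
* M. Abramowitz, I. Stegun, *Handbook of Mathematical Functions*, §5.1 (5.1.3, 5.1.10).
-/

noncomputable section

open Real Filter Asymptotics Set
open scoped Nat Topology

namespace Literature.NumberTheory.LFunctions

/-- The general term `(log x)^(n+1) / ((n+1) · (n+1)!)` of Ramanujan's (Nielsen's) series for the
logarithmic integral, indexed from `n = 0` so that no `0`-th junk term appears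
(Berndt, *Ramanujan's Notebooks* IV, ch. 24; Abramowitz–Stegun 5.1.10). [folklore] -/
def logIntegralSeriesTerm (x : ℝ) (n : ℕ) : ℝ :=
  Real.log x ^ (n + 1) / ((n + 1 : ℝ) * ((n + 1)! : ℝ))

/-- The logarithmic integral `li x = p.v. ∫₀ˣ dt / log t`, defined for `x > 1` through the
absolutely convergent series `li x = γ + log (log x) + ∑_{n ≥ 1} (log x)^n / (n · n!)`
(Abramowitz–Stegun 5.1.3 and 5.1.10 with `li x = Ei (log x)`; Berndt, *Ramanujan's Notebooks* IV,
ch. 24). For `x ≤ 1` the value is junk (see the module docstring); this is the `li` of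
von Koch's criterion `π x − li x = O(√x log x)` (outline D-ANT-7). [folklore] -/
def logIntegral (x : ℝ) : ℝ :=
  Real.eulerMascheroniConstant + Real.log (Real.log x) + ∑' n, logIntegralSeriesTerm x n

/-- The offset (Eulerian) logarithmic integral `Li x = ∫₂ˣ dt / log t`
(Schoenfeld 1976, §1; outline D-ANT-7). For `x < 2` the usual sign convention of
`intervalIntegral` applies. [cite: Schoenfeld1976, §1] -/
def offsetLogIntegral (x : ℝ) : ℝ :=
  ∫ t in (2 : ℝ)..x, (Real.log t)⁻¹

/-- The higher offset logarithmic integral `Li_k x = ∫₂ˣ dt / (log t)^k`, the main term in the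
Hardy–Littlewood `k`-tuple conjecture (Hardy–Littlewood 1923, *Partitio Numerorum* III,
Conjecture B; outline D-ANT-7). For `k = 1` this is `offsetLogIntegral`
(`offsetLogIntegralPow_one`). [cite: HardyLittlewood1923, Partitio Numerorum  III  Conjecture B] -/
def offsetLogIntegralPow (k : ℕ) (x : ℝ) : ℝ :=
  ∫ t in (2 : ℝ)..x, (Real.log t)⁻¹ ^ k

/-! ### Basic API (proofs deferred) -/

/-- Ramanujan's series for `li` converges (absolutely) for every real `x`; in particular for
`x > 1` it sums to `li x − γ − log log x` (Berndt, *Ramanujan's Notebooks* IV, ch. 24;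
Abramowitz–Stegun 5.1.10). [cite: AbramowitzStegun1964, 5.1.10; Berndt Ramanujan Notebooks IV ch. 24] -/
def hasSum_logIntegral_series : Prop :=
  ∀ {x : ℝ} (hx : 1 < x),
    HasSum (logIntegralSeriesTerm x)
      (logIntegral x - Real.eulerMascheroniConstant - Real.log (Real.log x))

/-- The bridge between the two conventions: `li x − li 2 = Li x` for `x > 1`
(Abramowitz–Stegun 5.1.3; outline D-ANT-7). [cite: AbramowitzStegun1964, 5.1.3] -/
def logIntegral_sub_logIntegral_two : Prop :=
  ∀ {x : ℝ} (hx : 1 < x),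
    logIntegral x - logIntegral 2 = offsetLogIntegral x

/-- `li` is differentiable on `(1, ∞)` with `li' x = 1 / log x`
(Abramowitz–Stegun 5.1.3, differentiating 5.1.10). [cite: AbramowitzStegun1964, 5.1.3] -/
def hasDerivAt_logIntegral : Prop :=
  ∀ {x : ℝ} (hx : 1 < x),
    HasDerivAt logIntegral (Real.log x)⁻¹ x

/-- `Li` is differentiable on `(1, ∞)` with `Li' x = 1 / log x` (fundamental theorem of
calculus; Schoenfeld 1976, §1). [cite: Schoenfeld1976, §1] -/
def hasDerivAt_offsetLogIntegral : Prop :=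
  ∀ {x : ℝ} (hx : 1 < x),
    HasDerivAt offsetLogIntegral (Real.log x)⁻¹ x

/-- `Li_k` is differentiable on `(1, ∞)` with derivative `1 / (log x)^k` (fundamental theorem
of calculus). [cite: AbramowitzStegun1964, 5.1.3 (fundamental theorem of calculus)] -/
def hasDerivAt_offsetLogIntegralPow : Prop :=
  ∀ (k : ℕ) {x : ℝ} (hx : 1 < x),
    HasDerivAt (offsetLogIntegralPow k) ((Real.log x)⁻¹ ^ k) x

/-- `li` is strictly increasing on `(1, ∞)` (its derivative `1 / log x` is positive there;
Abramowitz–Stegun 5.1.3). [cite: AbramowitzStegun1964, 5.1.3] -/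
def strictMonoOn_logIntegral : Prop :=
  StrictMonoOn logIntegral (Ioi 1)

/-- `Li` is strictly increasing on `(1, ∞)` (Schoenfeld 1976, §1). [cite: Schoenfeld1976, §1] -/
def strictMonoOn_offsetLogIntegral : Prop :=
  StrictMonoOn offsetLogIntegral (Ioi 1)

/-- `Li_1 = Li` (definitional up to `x⁻¹ ^ 1 = x⁻¹`). [folklore] -/
theorem offsetLogIntegralPow_one : offsetLogIntegralPow 1 = offsetLogIntegral := by
  funext x
  simp [offsetLogIntegralPow, offsetLogIntegral]

/-- `Li_0 x = x − 2`. [folklore] -/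
theorem offsetLogIntegralPow_zero (x : ℝ) : offsetLogIntegralPow 0 x = x - 2 := by
  simp [offsetLogIntegralPow]

/-- `Li 2 = 0`. [folklore] -/
@[simp] theorem offsetLogIntegral_two : offsetLogIntegral 2 = 0 := by
  simp [offsetLogIntegral]

/-- `Li_k 2 = 0`. [folklore] -/
@[simp] theorem offsetLogIntegralPow_two (k : ℕ) : offsetLogIntegralPow k 2 = 0 := by
  simp [offsetLogIntegralPow]

/-- `li 2 > 0`; numerically `li 2 = 1.04516…` (Abramowitz–Stegun, Table 5.1; Schoenfeld 1976
uses `li 2 ≈ 1.0452`). [cite: Schoenfeld1976, uses  li 2 ≈ 1.0452] -/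
def logIntegral_two_pos : Prop :=
  0 < logIntegral 2

/-! ### Asymptotics -/

/-- `li x ∼ x / log x` as `x → ∞` (integration by parts; e.g. Abramowitz–Stegun 5.1.51 via
`li x = Ei (log x)`). [cite: AbramowitzStegun1964, 5.1.51 via li x = Ei(log x)] -/
def isEquivalent_logIntegral : Prop :=
  logIntegral ~[atTop] fun x => x / Real.log x

/-- `Li x ∼ x / log x` as `x → ∞` (Schoenfeld 1976, §1). [cite: Schoenfeld1976, §1] -/
def isEquivalent_offsetLogIntegral : Prop :=
  offsetLogIntegral ~[atTop] fun x => x / Real.log x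

/-- `Li_k x ∼ x / (log x)^k` as `x → ∞`, for every `k` (integration by parts; Hardy–Littlewood
1923, *Partitio Numerorum* III, §5). [cite: HardyLittlewoodPN3, §5] -/
def isEquivalent_offsetLogIntegralPow : Prop :=
  ∀ (k : ℕ),
    offsetLogIntegralPow k ~[atTop] fun x => x / Real.log x ^ k

/-- `li x − Li x = li 2` is eventually negligible: `li ∼ Li` at `+∞`. [cite: AbramowitzStegun1964, 5.1.3 (li − Li = li 2 constant)] -/
def isEquivalent_logIntegral_offsetLogIntegral : Prop :=
  logIntegral ~[atTop] offsetLogIntegral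

end Literature.NumberTheory.LFunctions
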